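import Literature.Combinatorics.StablePolynomials.RightHalfPlaneStabilityPreservers
import Literature.Combinatorics.StablePolynomials.KernelForm
import Mathlib.Data.Finset.SymmDiff
import HarnessLib

/-!
# The convolution `f ⋆ g` of weakly Hurwitz stable multi-affine polynomials (Borcea–Brändén II, Theorem 8.7)

J. Borcea, P. Brändén, *The Lee–Yang and Pólya–Schur programs. II.*, Comm. Pure Appl. Math. 62 (2009)
1595–1631 (arXiv:0809.3087), §8.2:

> Closely related to the Schur–Hadamard product is the convolution operator on multi-affine polynomials [COSW]
> defined as follows: if `f(z) = Σ_{S⊆[n]} a(S) z^S` and `g(z) = Σ_{S⊆[n]} b(S) z^S` then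
> `(f ⋆ g)(z) = Σ_{S,T ⊆ [n]} a(S) b(T) z^{S Δ T}`, where `S Δ T = (S ∪ T) ∖ (S ∩ T)`. …
>
> **Theorem 8.7.** Let `f, g ∈ ℂ_{(1ⁿ)}[z_1,…,z_n]`. If `f, g` are weakly Hurwitz stable then so is `f ⋆ g` unless
> it is identically zero.
>
> *Proof.* Let `g` be a fixed `H_{π/2}`-stable multi-affine polynomial in `n` variables and let `T` be the linear
> transformation on multi-affine polynomials in `n` variables given by `T(f) = f ⋆ g`. The symbol of `T` … is just
> `iⁿ T[(z+w)^{[n]}] = (z+w)^{[n]} g((1+z_1w_1)/(z_1+w_1), …, (1+z_nw_n)/(z_n+w_n))`. Now if `u, v ∈ H_{π/2}` then also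
> `u^{-1}, v^{-1}, u+v ∈ H_{π/2}` hence `(1+uv)/(u+v) = (u+v)^{-1} + (u^{-1}+v^{-1})^{-1} ∈ H_{π/2}`, so that the
> polynomial … is `H_{π/2}`-stable (in `2n` variables). Theorem 3.2 again yields the desired conclusion.

Weak Hurwitz stability is `H_{π/2}`-stability (`IsHThetaStable (π/2)`, non-vanishing when all `Re z_i > 0`,
`isHThetaStable_pi_div_two_iff`). The tree's Theorem 3.2 for `C = H_{π/2}`
(`BorceaBranden_rightHalfPlaneStabilityPreserver_iff`) is stated with the symbol `T[(1+zw)^κ]`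
(`boundedDegreeSymbolD`); for `T = (·) ⋆ g` this symbol is `Π_i(1+z_iw_i) · g((z_1+w_1)/(1+z_1w_1),…)`, the same
function up to the factor `(z+w)^{[n]}/(1+zw)^{[n]}` and the inversion `u ↦ u^{-1}` of `H_{π/2}`, and the printed
membership `(1+uv)/(u+v) ∈ H_{π/2}` is used through its inverse.

## Contents

* §1 `convOp b` (the linear operator `z^S ↦ Σ_T b(T) z^{SΔT}`), `multiAffineConv a b` (`f ⋆ g`),
  `convOp_multiAffine`.
* §2 `sum_prod_mul_prod_symmDiff` (`Σ_S w^S z^{SΔT} = Π_{i∈T}(z_i+w_i) Π_{i∉T}(1+z_iw_i)`), `eval_convOp_prod_one_add`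
  (the symbol), `re_add_div_one_add_mul_pos` (`(u+v)/(1+uv) ∈ H_{π/2}`),
  `isHThetaStable_boundedDegreeSymbolD_convOp`.
* §3 **`multiAffineConv_weaklyHurwitzStable`** (Theorem 8.7) and its `IsMultiAffine` form
  `IsHThetaStable.multiAffineConv`.

## References

* [BorceaBranden2009II] J. Borcea, P. Brändén, Comm. Pure Appl. Math. 62 (2009) 1595–1631, §8.2 Thm 8.7.
* Y. Choe, J. Oxley, A. Sokal, D. Wagner, *Homogeneous multivariate polynomials with the half-plane property*,
  Adv. Appl. Math. 32 (2004) (the reference [COSW] of [BorceaBranden2009II], where `⋆` and the result originate).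
-/

noncomputable section

open MvPolynomial Finset

open scoped symmDiff

namespace Literature.Combinatorics.StablePolynomials

variable {σ : Type*} [Fintype σ] [DecidableEq σ]

/-! ## §1 The convolution operator -/

section Operator

omit [Fintype σ] in
/-- The support of the exponent vector `𝟙_S` is `S`. [cite: BorceaBranden2009, §2.1 (`z^S`)] -/
theorem support_sum_single_one (S : Finset σ) : (∑ i ∈ S, Finsupp.single i 1 : σ →₀ ℕ).support = S := by
  ext j
  rw [Finsupp.mem_support_iff, sum_single_one_apply]
  by_cases h : j ∈ S <;> simp [h]

/-- **The operator `T = (·) ⋆ g`** for `g = Σ_T b(T) z^T`: the linear map `z^s ↦ Σ_T b(T) z^{supp(s) Δ T}` (on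
square-free monomials `z^S ↦ Σ_T b(T) z^{SΔT}`, as printed; the values on other monomials are immaterial).
[cite: BorceaBranden2009II, §8.2 proof of Thm. 8.7 ("`T(f) = f ⋆ g`")] -/
def convOp (b : Finset σ → ℂ) : MvPolynomial σ ℂ →ₗ[ℂ] MvPolynomial σ ℂ :=
  (basisMonomials σ ℂ).constr ℂ fun s => ∑ T : Finset σ, b T • ∏ i ∈ s.support ∆ T, X i

/-- `convOp` on a monomial. [cite: BorceaBranden2009II, §8.2 proof of Thm. 8.7] -/
theorem convOp_monomial (b : Finset σ → ℂ) (s : σ →₀ ℕ) (c : ℂ) :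
    convOp b (monomial s c) = c • ∑ T : Finset σ, b T • ∏ i ∈ s.support ∆ T, X i := by
  have h : (monomial s c : MvPolynomial σ ℂ) = c • basisMonomials σ ℂ s := by
    rw [coe_basisMonomials, smul_monomial, smul_eq_mul, mul_one]
  rw [h, map_smul, convOp, Module.Basis.constr_basis]

/-- **`T(z^S) = Σ_T b(T) z^{SΔT}`.** [cite: BorceaBranden2009II, §8.2 proof of Thm. 8.7] -/
theorem convOp_prod_X (b : Finset σ → ℂ) (S : Finset σ) :
    convOp b (∏ i ∈ S, X i) = ∑ T : Finset σ, b T • ∏ i ∈ S ∆ T, X i := by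
  rw [prod_X_eq_monomial, convOp_monomial, one_smul, support_sum_single_one]

/-- **The convolution `f ⋆ g = Σ_{S,T} a(S) b(T) z^{SΔT}`** of `f = Σ a(S)z^S` and `g = Σ b(T)z^T`.
[cite: BorceaBranden2009II, §8.2 (definition of `f ⋆ g`, after [COSW])] -/
def multiAffineConv (a b : Finset σ → ℂ) : MvPolynomial σ ℂ :=
  ∑ S : Finset σ, ∑ T : Finset σ, (a S * b T) • ∏ i ∈ S ∆ T, X i

/-- `T(f) = f ⋆ g`. [cite: BorceaBranden2009II, §8.2 proof of Thm. 8.7] -/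
theorem convOp_multiAffine (a b : Finset σ → ℂ) : convOp b (multiAffine a) = multiAffineConv a b := by
  rw [multiAffine, map_sum, multiAffineConv]
  refine sum_congr rfl fun S _ => ?_
  rw [← smul_eq_C_mul, map_smul, convOp_prod_X, smul_sum]
  exact sum_congr rfl fun T _ => by rw [smul_smul]

end Operator

/-! ## §2 The symbol of `T = (·) ⋆ g` -/

section Symbol

/-- `Π_{i∈S} u_i = Π_i (u_i if i ∈ S else 1)`. [folklore] -/
private theorem prod_mem_eq_prod_univ_ite (S : Finset σ) (u : σ → ℂ) :
    ∏ i ∈ S, u i = ∏ i, if i ∈ S then u i else 1 := by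
  rw [prod_ite_mem, univ_inter]

/-- **`Σ_S w^S z^{SΔT} = Π_{i∈T}(z_i + w_i) · Π_{i∉T}(1 + z_i w_i)`** (coordinatewise: for `i ∈ T` the choices
`i ∈ S`/`i ∉ S` contribute `w_i`/`z_i`, for `i ∉ T` they contribute `z_iw_i`/`1`).
[cite: BorceaBranden2009II, §8.2 proof of Thm. 8.7 (computation of the symbol)] -/
theorem sum_prod_mul_prod_symmDiff (T : Finset σ) (z w : σ → ℂ) :
    ∑ S : Finset σ, (∏ i ∈ S, w i) * ∏ i ∈ S ∆ T, z i =
      (∏ i ∈ T, (z i + w i)) * ∏ i ∈ Tᶜ, (1 + z i * w i) := by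
  have hprod : (∏ i ∈ T, (z i + w i)) * ∏ i ∈ Tᶜ, (1 + z i * w i) =
      ∏ i, ((if i ∈ T then w i else z i * w i) + (if i ∈ T then z i else 1)) := by
    rw [← prod_mul_prod_compl T (fun i => (if i ∈ T then w i else z i * w i) + (if i ∈ T then z i else 1))]
    congr 1
    · exact prod_congr rfl fun i hi => by simp only [if_pos hi]; ring
    · exact prod_congr rfl fun i hi => by simp only [if_neg (mem_compl.1 hi)]; ring
  rw [hprod, prod_add, powerset_univ]
  refine sum_congr rfl fun S _ => ?_
  rw [← compl_eq_univ_sdiff, prod_mem_eq_prod_univ_ite S, prod_mem_eq_prod_univ_ite (S ∆ T),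
    prod_mem_eq_prod_univ_ite S, prod_mem_eq_prod_univ_ite Sᶜ, ← prod_mul_distrib, ← prod_mul_distrib]
  refine prod_congr rfl fun i _ => ?_
  by_cases hS : i ∈ S <;> by_cases hT : i ∈ T <;> simp [hS, hT, mem_symmDiff, mul_comm]

/-- **The symbol of `T = (·) ⋆ g`** in the tree's normalisation:
`T[Π_i(1 + w_i z_i)](z) = Σ_T b(T) Π_{i∈T}(z_i+w_i) Π_{i∉T}(1+z_iw_i)` (`= Π_i(1+z_iw_i) · g((z+w)/(1+zw))`).
[cite: BorceaBranden2009II, §8.2 proof of Thm. 8.7, eq. for `T[(z+w)^{[n]}]`] -/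
theorem eval_convOp_prod_one_add (b : Finset σ → ℂ) (z w : σ → ℂ) :
    eval z (convOp b (∏ i, (1 + C (w i) * X i) ^ (fun _ : σ => 1) i)) =
      ∑ T : Finset σ, b T * ((∏ i ∈ T, (z i + w i)) * ∏ i ∈ Tᶜ, (1 + z i * w i)) := by
  have h1 : (∏ i, (1 + C (w i) * X i) ^ (fun _ : σ => 1) i : MvPolynomial σ ℂ) =
      ∑ S : Finset σ, (∏ i ∈ S, w i) • ∏ i ∈ S, X i := by
    simp only [pow_one]
    rw [prod_one_add, powerset_univ]
    refine sum_congr rfl fun S _ => ?_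
    rw [prod_mul_distrib, ← map_prod, smul_eq_C_mul]
  rw [h1, map_sum, map_sum]
  simp_rw [map_smul, convOp_prod_X, smul_sum, smul_smul, map_sum, smul_eval, map_prod, eval_X]
  rw [sum_comm]
  refine sum_congr rfl fun T _ => ?_
  rw [← sum_prod_mul_prod_symmDiff T z w, mul_sum]
  exact sum_congr rfl fun S _ => by ring

omit [Fintype σ] [DecidableEq σ] in
/-- `1 + uv ≠ 0` for `u, v ∈ H_{π/2}`. [cite: BorceaBranden2009II, §8.2 proof of Thm. 8.7] -/
theorem one_add_mul_ne_zero_of_re_pos {u v : ℂ} (hu : 0 < u.re) (hv : 0 < v.re) : 1 + u * v ≠ 0 := by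
  intro h
  have hu0 : u ≠ 0 := fun h0 => by rw [h0, Complex.zero_re] at hu; exact lt_irrefl _ hu
  have hv' : v = -u⁻¹ := by field_simp; linear_combination h
  have : v.re < 0 := by
    rw [hv', Complex.neg_re, Complex.inv_re, neg_lt_zero]
    exact div_pos hu (Complex.normSq_pos.2 hu0)
  exact lt_asymm this hv

omit [Fintype σ] [DecidableEq σ] in
/-- `Re ζ > 0 ⇒ Re ζ⁻¹ > 0`. [cite: BorceaBranden2009II, §8.2 proof of Thm. 8.7 ("`u^{-1}, v^{-1} ∈ H_{π/2}`")] -/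
theorem inv_re_pos_of_re_pos {ζ : ℂ} (h : 0 < ζ.re) : 0 < ζ⁻¹.re := by
  have h0 : ζ ≠ 0 := fun h0 => by rw [h0, Complex.zero_re] at h; exact lt_irrefl _ h
  rw [Complex.inv_re]
  exact div_pos h (Complex.normSq_pos.2 h0)

omit [Fintype σ] [DecidableEq σ] in
/-- **`(u+v)/(1+uv) ∈ H_{π/2}` for `u, v ∈ H_{π/2}`**, via the printed
`(1+uv)/(u+v) = (u+v)^{-1} + (u^{-1}+v^{-1})^{-1} ∈ H_{π/2}` and inversion.
[cite: BorceaBranden2009II, §8.2 proof of Thm. 8.7] -/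
theorem re_add_div_one_add_mul_pos {u v : ℂ} (hu : 0 < u.re) (hv : 0 < v.re) :
    0 < ((u + v) / (1 + u * v)).re := by
  have hu0 : u ≠ 0 := fun h0 => by rw [h0, Complex.zero_re] at hu; exact lt_irrefl _ hu
  have hv0 : v ≠ 0 := fun h0 => by rw [h0, Complex.zero_re] at hv; exact lt_irrefl _ hv
  have huv : 0 < (u + v).re := by rw [Complex.add_re]; exact add_pos hu hv
  have huv0 : u + v ≠ 0 := fun h0 => by rw [h0, Complex.zero_re] at huv; exact lt_irrefl _ huv
  have hsum : 0 < ((u + v)⁻¹ + (u⁻¹ + v⁻¹)⁻¹).re := by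
    rw [Complex.add_re]
    refine add_pos (inv_re_pos_of_re_pos huv) (inv_re_pos_of_re_pos ?_)
    rw [Complex.add_re]
    exact add_pos (inv_re_pos_of_re_pos hu) (inv_re_pos_of_re_pos hv)
  have h3 : u⁻¹ + v⁻¹ = (u + v) / (u * v) := by
    field_simp
    ring
  have hid : (u + v) / (1 + u * v) = ((u + v)⁻¹ + (u⁻¹ + v⁻¹)⁻¹)⁻¹ := by
    rw [h3, inv_div, inv_eq_one_div (u + v), ← add_div, inv_div]
  rw [hid]
  exact inv_re_pos_of_re_pos hsum

/-- **The symbol of `T = (·) ⋆ g` is weakly Hurwitz stable** (in `2n` variables) for weakly Hurwitz stable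
`g = Σ b(T) z^T`. [cite: BorceaBranden2009II, §8.2 proof of Thm. 8.7] -/
theorem isHThetaStable_boundedDegreeSymbolD_convOp {b : Finset σ → ℂ}
    (hg : IsHThetaStable (Real.pi / 2) (multiAffine b)) :
    IsHThetaStable (Real.pi / 2) (boundedDegreeSymbolD (fun _ : σ => 1) (convOp b)) := by
  rw [isHThetaStable_pi_div_two_iff] at hg ⊢
  intro zw hzw
  rw [← Sum.elim_comp_inl_inr zw, eval_boundedDegreeSymbolD, eval_convOp_prod_one_add]
  set z : σ → ℂ := zw ∘ Sum.inl with hz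
  set w : σ → ℂ := zw ∘ Sum.inr with hw
  have hzr : ∀ i, 0 < (z i).re := fun i => hzw _
  have hwr : ∀ i, 0 < (w i).re := fun i => hzw _
  have hne : ∀ i, 1 + z i * w i ≠ 0 := fun i => one_add_mul_ne_zero_of_re_pos (hzr i) (hwr i)
  -- factor out `Π_i (1 + z_i w_i)`
  set u : σ → ℂ := fun i => (z i + w i) / (1 + z i * w i) with hu
  have hfac : ∀ T : Finset σ, (∏ i ∈ T, (z i + w i)) * ∏ i ∈ Tᶜ, (1 + z i * w i) =
      (∏ i, (1 + z i * w i)) * ∏ i ∈ T, u i := by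
    intro T
    have h1 : ∏ i ∈ T, (z i + w i) = (∏ i ∈ T, (1 + z i * w i)) * ∏ i ∈ T, u i := by
      rw [← prod_mul_distrib]
      exact prod_congr rfl fun i _ => by rw [hu]; exact (mul_div_cancel₀ _ (hne i)).symm
    rw [h1, mul_right_comm, prod_mul_prod_compl]
  simp_rw [hfac]
  have hrw : ∑ T : Finset σ, b T * ((∏ i, (1 + z i * w i)) * ∏ i ∈ T, u i) =
      (∏ i, (1 + z i * w i)) * eval u (multiAffine b) := by
    rw [eval_multiAffine, mul_sum]
    exact sum_congr rfl fun T _ => by ring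
  rw [hrw]
  refine mul_ne_zero (prod_ne_zero_iff.2 fun i _ => hne i) (hg u fun i => ?_)
  exact re_add_div_one_add_mul_pos (hzr i) (hwr i)

end Symbol

/-! ## §3 Theorem 8.7 -/

section Theorem

/-- **Borcea–Brändén II, Theorem 8.7** ([COSW]): if `f = Σ a(S)z^S` and `g = Σ b(T)z^T` are weakly Hurwitz stable
(`H_{π/2}`-stable) multi-affine polynomials, then `f ⋆ g = Σ_{S,T} a(S)b(T) z^{SΔT}` is weakly Hurwitz stable unless it
is identically zero. Proof as printed: `T = (·) ⋆ g` has a weakly Hurwitz stable symbol; Theorem 3.2 for `H_{π/2}`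
(`BorceaBranden_rightHalfPlaneStabilityPreserver_iff`). [cite: BorceaBranden2009II, §8.2 Thm. 8.7] -/
theorem multiAffineConv_weaklyHurwitzStable {a b : Finset σ → ℂ}
    (hf : IsHThetaStable (Real.pi / 2) (multiAffine a)) (hg : IsHThetaStable (Real.pi / 2) (multiAffine b)) :
    IsHThetaStable (Real.pi / 2) (multiAffineConv a b) ∨ multiAffineConv a b = 0 := by
  rw [← convOp_multiAffine]
  exact (BorceaBranden_rightHalfPlaneStabilityPreserver_iff (fun _ : σ => 1) (convOp b)).2
    (Or.inr (isHThetaStable_boundedDegreeSymbolD_convOp hg)) (multiAffine a) (isMultiAffine_multiAffine a) hf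

/-- **Theorem 8.7 for multi-affine `f, g`** given as polynomials (`a(S) = [z^S]f`, `b(T) = [z^T]g`).
[cite: BorceaBranden2009II, §8.2 Thm. 8.7] -/
theorem IsHThetaStable.multiAffineConv {f g : MvPolynomial σ ℂ} (hfm : IsMultiAffine f) (hgm : IsMultiAffine g)
    (hf : IsHThetaStable (Real.pi / 2) f) (hg : IsHThetaStable (Real.pi / 2) g) :
    IsHThetaStable (Real.pi / 2)
        (multiAffineConv (fun S => coeff (∑ i ∈ S, Finsupp.single i 1) f)
          (fun T => coeff (∑ i ∈ T, Finsupp.single i 1) g)) ∨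
      multiAffineConv (fun S => coeff (∑ i ∈ S, Finsupp.single i 1) f)
        (fun T => coeff (∑ i ∈ T, Finsupp.single i 1) g) = 0 := by
  refine multiAffineConv_weaklyHurwitzStable ?_ ?_
  · rw [← eq_multiAffine_of_isMultiAffine hfm]; exact hf
  · rw [← eq_multiAffine_of_isMultiAffine hgm]; exact hg

end Theorem

end Literature.Combinatorics.StablePolynomials

end
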